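import Summits.ABC.IUTFork.ForkPacketReal
import HarnessLib

/-!
# The fork at [IUTchIII] Corollary 3.12 — the PRE-HULL readings at one real summand fail with NO slack (skeleton XXVIb)

Record-only file (D-0012) of the abc-iut cell (deliverable (a), skeleton seat abc-iut-skel, gen 6); TAKES NO SIDE.
Sequel to XXVI (`ForkPacketReal`, p417081): there the HULL-level summand readings (R0 volume, R2/R3 set, R4/R4′
iso-containment) fail once the q-value is shallower than the shallowest theta slot by MORE than the [IUTchIV]
Prop. 1.4 discrepancy `{d_I + 1}·log(p) + Σ{3 + log(e_i)}` — the slack the holomorphic hull can add. The readings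
that do NOT pass through the hull — Team B's single-image volume transport (`Cor312Vol.VolumeTransport` /
`GlobalVolumeTransport`: the q-pilot volume against the volume of ONE chosen Kummer image `thetaRegion m`, B1
p411119/p414039, «PRE-HULL-sharp» in B1's own words) and the volume-level representation R1 / LANA (9-1)
(`Cor312Vol.RepresentedVol`, skeleton VIII/XV/XVII: the q-pilot log-volume IS the log-volume of one possible
image) — are compared here, at ONE SUMMAND `v⃗` of c312-3's real prime packet, with what the (Ind1)·(Ind2)-orbit
of sharp (Ind3)-data can offer BEFORE the hull:

* `PacketReal.logμ_le_of_subset_orbitMember` — every admissible sub-region `A` of every orbit member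
  `g·perm_σ(B_{v⃗∘σ})` has `log μ̄(A) ≤ log‖t_{v_{σ(j)}}‖ ≤ log‖t_{v_{i₀}}‖` (the shallowest theta slot): (Ind1)
  transports the bare region of `v⃗∘σ` to the twist of `O_{v⃗}` by the SAME scalar at slot `σ(j)` (c312-d1
  `realPrimePacket_perm_image_bare`), (Ind2) preserves `log μ̄` (Dupuy–Hilado §4.9, the model's `logμ_smul`),
  `log μ̄` is monotone — NO discrepancy term: the `{d_I + 1}·log(p) + Σ…` of Step (v) is entirely the hull's;
* `PacketReal.SingleImageReading` — the summand-level form of the pre-hull readings: SOME admissible sub-region of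
  SOME orbit member carries at least the q-pilot region's log-volume (covers B's transport at the summand with
  `g = 1, σ = 1, A = B_{v⃗}`, R1's equality, and their (Ind2)-iso variants);
* **`PacketReal.not_singleImageReading`** — FALSE as soon as `log‖t_{v_{i₀}}‖ < log‖q̲‖`, and with the printed
  Θ-weights (`not_singleImageReading_thetaWeights`: diagonal summand, `‖t_v‖ = ‖q̲‖^{j²}`) FALSE for EVERY `j ≥ 2`
  at EVERY place where `q̲` is a non-unit (`‖q̲‖ < 1`, i.e. every bad place: `ord_v(q̲_v) > 0`, [IUTchI] Def. 3.1
  (b)(c); c312-4 `LanaQPilotTheta` proves `ord_v(q_v) > 0` from multiplicative reduction) — NO depth condition;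
  non-vacuity `singleImage_hypotheses_satisfiable`.

So, at the summand level of the sharp-(Ind3) real model, the pre-hull readings die at every bad place and every
label `j ≥ 2` by the Θ-weights ALONE ([IUTchIV] Step (v) p. 28 weight `j²`, printed per element as
"`− j²/(2l(j+1))·log(q_v)`" and after the weighted average as "`− j²/2l·log(q_{v_ℚ})`", against the q-pilot's
"`−(1/2l)·log(q_v)`"; Scholze–Stix 2018 §2.1.8 "scaled by `j²`"; the skeleton's (Syp2) `ForkInflation.
logvol_bare_lt_negAbsLogq` now at a real packet): whatever makes the printed inequality true in the intended model
is the HULL (and the averaging against good places), not the transport of single images. HONEST SCOPE as in XXVI: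
summand level (= c312-7's `(j, p)`-packet when `𝕍` has one element over `p`); sharp (Ind3); the GLOBAL pre-hull
forms (B's `GlobalVolumeTransport`, R1) are signed weighted sums over summands and places — at good places both
sides are units (`0 = 0`), at bad places the summand comparison is STRICT for `j ≥ 2` — whose kernel assembly over
`Cor312.Setting.ofComparison` is the bridge owners' (A-0/B-2); nothing here is about the printed hull-level
GLOBAL inequality `Cor312.Setting.Statement`. Sources: [IUTchIII] kurims `paper:url-4b091feeb646` pp. 173–174,
183–185; [IUTchIV] kurims `paper:url-56bcb0f95768` pp. 27–28; Dupuy–Hilado arXiv:2004.13228 §3.9, §4.7, §4.9;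
LANA report §8.3 p. 43, §9.2–9.3 p. 46. [claim: Mochizuki2012, status: disputed]; [cite: DupuyHilado2025, §3.9,
§4.7, §4.9]; [cite: LANA2026Report, §9.3 p. 46]. typed ≠ proved; no side taken.
-/

noncomputable section

open Set MeasureTheory NumberField IsDedekindDomain
open scoped Pointwise

namespace Summit.ABC.IUTFork.PacketReal

open Literature.IUT.LogVolume

variable {F : Type} [Field F] [NumberField F]
variable (p : ℕ) [Fact p.Prime] (𝔽 : LocalFields F p)

/-! ## 1. What an orbit member can carry, before the hull -/

/-- **Every admissible sub-region of every orbit member has `log μ̄ ≤` the shallowest theta slot.** For sharp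
(Ind3)-data `B_σ ⊆ t_{v_{σ(j)}}·O_{v⃗∘σ}` and `i₀` a slot of largest norm: `A ⊆ g·perm_σ(B_{v⃗∘σ})` admissible ⇒
`log μ̄(A) ≤ log‖t_{v_{i₀}}‖`. (Ind1) moves the bare region to the twist of `O_{v⃗}` by the same scalar at slot
`σ(j)` (c312-d1), (Ind2) preserves `log μ̄` (Dupuy–Hilado §4.9), monotonicity — no discrepancy term.
[cite: DupuyHilado2025, §3.9, §4.7, §4.9] -/
theorem logμ_le_of_subset_orbitMember {j : ℕ} (e : Fin (j + 1) → placesOver F p)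
    (t : ∀ v : placesOver F p, (𝔽.k v)ˣ) (B : (realPrimePacket p 𝔽).Region)
    (hB : ∀ σ : Equiv.Perm (Fin (j + 1)), B j (e ∘ σ) ⊆ pilotRegion p 𝔽 (e ∘ σ) (t (e (σ (Fin.last j)))))
    (i₀ : Fin (j + 1)) (hmax : ∀ i, ‖(t (e i) : 𝔽.k (e i))‖ ≤ ‖(t (e i₀) : 𝔽.k (e i₀))‖)
    (g : (realPrimePacket p 𝔽).G₂ j e) (σ : Equiv.Perm (Fin (j + 1))) {A : Set ((realPrimePacket p 𝔽).X j e)}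
    (hA : (realPrimePacket p 𝔽).adm A) (hAsub : A ⊆ g • ((realPrimePacket p 𝔽).perm σ e '' B j (e ∘ σ))) :
    (realPrimePacket p 𝔽).logμ A ≤ Real.log ‖(t (e i₀) : 𝔽.k (e i₀))‖ := by
  set W : Set ((realPrimePacket p 𝔽).X j e) :=
    (realPrimePacket p 𝔽).perm σ e '' pilotRegion p 𝔽 (e ∘ σ) (t (e (σ (Fin.last j)))) with hW
  have hBadm : (realPrimePacket p 𝔽).adm (pilotRegion p 𝔽 (e ∘ σ) (t (e (σ (Fin.last j))))) :=
    adm_pilotRegion p 𝔽 (e ∘ σ) _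
  have hWadm : (realPrimePacket p 𝔽).adm W := (realPrimePacket p 𝔽).perm_adm σ e hBadm
  have hWvol : (realPrimePacket p 𝔽).logμ W = Real.log ‖(t (e (σ (Fin.last j))) : 𝔽.k (e (σ (Fin.last j))))‖ :=
    ((realPrimePacket p 𝔽).logμ_perm σ e hBadm).trans (logμ_pilotRegion p 𝔽 (e ∘ σ) _)
  have hgWadm : (realPrimePacket p 𝔽).adm (g • W) := (realPrimePacket p 𝔽).smul_adm g hWadm
  have hgWvol : (realPrimePacket p 𝔽).logμ (g • W) =
      Real.log ‖(t (e (σ (Fin.last j))) : 𝔽.k (e (σ (Fin.last j))))‖ :=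
    ((realPrimePacket p 𝔽).logμ_smul g hWadm).trans hWvol
  have hsub : A ⊆ g • W := hAsub.trans (Set.smul_set_mono (Set.image_mono (hB σ)))
  have hpos : 0 < ‖(t (e (σ (Fin.last j))) : 𝔽.k (e (σ (Fin.last j))))‖ :=
    norm_pos_iff.mpr (t (e (σ (Fin.last j)))).ne_zero
  calc (realPrimePacket p 𝔽).logμ A ≤ (realPrimePacket p 𝔽).logμ (g • W) :=
        (realPrimePacket p 𝔽).logμ_mono hA hgWadm hsub
    _ = Real.log ‖(t (e (σ (Fin.last j))) : 𝔽.k (e (σ (Fin.last j))))‖ := hgWvol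
    _ ≤ Real.log ‖(t (e i₀) : 𝔽.k (e i₀))‖ := Real.log_le_log hpos (hmax _)

/-! ## 2. The pre-hull reading at the summand and its failure -/

/-- **The PRE-HULL reading at `v⃗`** (summand-level form of Team B's single-image volume transport
`Cor312Vol.VolumeTransport`/`GlobalVolumeTransport` — `g = 1`, `σ = 1`, `A = B_{v⃗}` — and of the volume-level
representation R1 / LANA (9-1) `Cor312Vol.RepresentedVol` with its (Ind2)-iso variants): SOME admissible sub-region
of SOME orbit member carries at least the q-pilot region's log-volume. HYPOTHESIS-shaped, never asserted.
[claim: Mochizuki2012, status: disputed] -/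
@[claim "Mochizuki2012" "disputed"]
def SingleImageReading {j : ℕ} (e : Fin (j + 1) → placesOver F p) (q : (𝔽.k (e (Fin.last j)))ˣ)
    (B : (realPrimePacket p 𝔽).Region) : Prop :=
  ∃ (g : (realPrimePacket p 𝔽).G₂ j e) (σ : Equiv.Perm (Fin (j + 1))) (A : Set ((realPrimePacket p 𝔽).X j e)),
    A ⊆ g • ((realPrimePacket p 𝔽).perm σ e '' B j (e ∘ σ)) ∧ (realPrimePacket p 𝔽).adm A ∧
      (realPrimePacket p 𝔽).logμ (pilotRegion p 𝔽 e q) ≤ (realPrimePacket p 𝔽).logμ A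

/-- Team B's transport at the summand — the q-pilot volume at most the volume of the (admissible) Θ-datum `B_{v⃗}`
itself — is the instance `g = 1, σ = 1, A = B_{v⃗}` of the pre-hull reading. [claim: Mochizuki2012, status: disputed] -/
theorem singleImageReading_of_transport {j : ℕ} {e : Fin (j + 1) → placesOver F p}
    {q : (𝔽.k (e (Fin.last j)))ˣ} {B : (realPrimePacket p 𝔽).Region} (hadm : (realPrimePacket p 𝔽).adm (B j e))
    (h : (realPrimePacket p 𝔽).logμ (pilotRegion p 𝔽 e q) ≤ (realPrimePacket p 𝔽).logμ (B j e)) :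
    SingleImageReading p 𝔽 e q B := by
  refine ⟨1, 1, B j e, ?_, hadm, h⟩
  rw [one_smul]
  intro x hx
  exact ⟨x, hx, (realPrimePacket p 𝔽).perm_one e x⟩

/-- The summand-level R1 (some orbit member, admissible, has EXACTLY the q-pilot region's log-volume) is an
instance of the pre-hull reading. [cite: LANA2026Report, §9.3 p. 46] -/
theorem singleImageReading_of_represented {j : ℕ} {e : Fin (j + 1) → placesOver F p}
    {q : (𝔽.k (e (Fin.last j)))ˣ} {B : (realPrimePacket p 𝔽).Region}
    (h : ∃ (g : (realPrimePacket p 𝔽).G₂ j e) (σ : Equiv.Perm (Fin (j + 1))),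
      (realPrimePacket p 𝔽).adm (g • ((realPrimePacket p 𝔽).perm σ e '' B j (e ∘ σ))) ∧
        (realPrimePacket p 𝔽).logμ (g • ((realPrimePacket p 𝔽).perm σ e '' B j (e ∘ σ))) =
          (realPrimePacket p 𝔽).logμ (pilotRegion p 𝔽 e q)) :
    SingleImageReading p 𝔽 e q B := by
  obtain ⟨g, σ, hadm, hvol⟩ := h
  exact ⟨g, σ, _, Subset.rfl, hadm, hvol.ge⟩

/-- **THE PRE-HULL READING FAILS at `v⃗` with NO slack**: for sharp (Ind3)-data around the theta values `t`, if
the shallowest theta slot is deeper than the q-value — `log‖t_{v_{i₀}}‖ < log‖q̲‖` — then no admissible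
sub-region of any orbit member carries the q-pilot region's log-volume. No `{d_I + 1}·log(p) + Σ…` term: that
slack is the hull's alone. [cite: DupuyHilado2025, §4.7, §4.9] -/
theorem not_singleImageReading {j : ℕ} (e : Fin (j + 1) → placesOver F p)
    (t : ∀ v : placesOver F p, (𝔽.k v)ˣ) (B : (realPrimePacket p 𝔽).Region)
    (hB : ∀ σ : Equiv.Perm (Fin (j + 1)), B j (e ∘ σ) ⊆ pilotRegion p 𝔽 (e ∘ σ) (t (e (σ (Fin.last j)))))
    (i₀ : Fin (j + 1)) (hmax : ∀ i, ‖(t (e i) : 𝔽.k (e i))‖ ≤ ‖(t (e i₀) : 𝔽.k (e i₀))‖)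
    (q : (𝔽.k (e (Fin.last j)))ˣ)
    (hlt : Real.log ‖(t (e i₀) : 𝔽.k (e i₀))‖ < Real.log ‖(q : 𝔽.k (e (Fin.last j)))‖) :
    ¬ SingleImageReading p 𝔽 e q B := by
  rintro ⟨g, σ, A, hAsub, hA, hle⟩
  have h1 := logμ_le_of_subset_orbitMember p 𝔽 e t B hB i₀ hmax g σ hA hAsub
  rw [logμ_pilotRegion] at hle
  linarith

/-- **With the printed Θ-weights: EVERY bad place, EVERY label `j ≥ 2`, NO depth condition.** On the diagonal
summand `v⃗ = (v, …, v)` with `‖t_v‖ = ‖q̲‖^{j²}` ([IUTchIV] Step (v) p. 28 weight `j²` — per element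
"`− j²/(2l(j+1))·log(q_v)`", averaged "`− j²/2l·log(q_{v_ℚ})`" — against the q-pilot's
`q̲_v`; SS 2018 §2.1.8), the pre-hull reading fails as soon as `q̲` is a non-unit of positive order (`‖q̲‖ < 1` —
every `v ∈ 𝕍^bad`: [IUTchI] Def. 3.1 (b)(c), `ord_v(q_v) > 0` proved by c312-4 `LanaQPilotTheta`) and `j ≥ 2`.
[cite: Mochizuki2012, IUTchIV Thm 1.10 proof Step (v) p.27–28] -/
theorem not_singleImageReading_thetaWeights {j : ℕ} (hj : 2 ≤ j) (v : placesOver F p)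
    (t : ∀ w : placesOver F p, (𝔽.k w)ˣ) (q : (𝔽.k v)ˣ)
    (hθ : ‖(t v : 𝔽.k v)‖ = ‖(q : 𝔽.k v)‖ ^ (j ^ 2)) (hq : ‖(q : 𝔽.k v)‖ < 1)
    (B : (realPrimePacket p 𝔽).Region)
    (hB : ∀ σ : Equiv.Perm (Fin (j + 1)),
      B j ((fun _ : Fin (j + 1) => v) ∘ σ) ⊆ pilotRegion p 𝔽 ((fun _ : Fin (j + 1) => v) ∘ σ) (t v)) :
    ¬ SingleImageReading p 𝔽 (fun _ : Fin (j + 1) => v) q B := by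
  have hqpos : 0 < ‖(q : 𝔽.k v)‖ := norm_pos_iff.mpr q.ne_zero
  have hlogq : Real.log ‖(q : 𝔽.k v)‖ < 0 := Real.log_neg hqpos hq
  have hlog : Real.log ‖(t v : 𝔽.k v)‖ = (j : ℝ) ^ 2 * Real.log ‖(q : 𝔽.k v)‖ := by
    rw [hθ, Real.log_pow]
    push_cast
    ring
  have hj2 : (1 : ℝ) < (j : ℝ) ^ 2 := by
    have h2 : (2 : ℝ) ≤ j := by exact_mod_cast hj
    nlinarith
  have hlt : Real.log ‖(t v : 𝔽.k v)‖ < Real.log ‖(q : 𝔽.k v)‖ := by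
    rw [hlog]
    nlinarith
  exact not_singleImageReading p 𝔽 (fun _ => v) t B hB (Fin.last j) (fun _ => le_rfl) q hlt

/-- **NON-VACUITY**: at every place `v | p` and every `j ≥ 2` the hypotheses of
`not_singleImageReading_thetaWeights` are jointly satisfiable in the real packet (`t := p^{j²}`, `q̲ := p`, `B :=`
the bare regions), so the pre-hull reading is REFUTED at explicit data of every real packet. [folklore] -/
theorem singleImage_hypotheses_satisfiable (j : ℕ) (v : placesOver F p) :
    ∃ (t : ∀ w : placesOver F p, (𝔽.k w)ˣ) (q : (𝔽.k v)ˣ) (B : (realPrimePacket p 𝔽).Region),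
      ‖(t v : 𝔽.k v)‖ = ‖(q : 𝔽.k v)‖ ^ (j ^ 2) ∧ ‖(q : 𝔽.k v)‖ < 1 ∧
      (∀ σ : Equiv.Perm (Fin (j + 1)),
        B j ((fun _ : Fin (j + 1) => v) ∘ σ) ⊆ pilotRegion p 𝔽 ((fun _ : Fin (j + 1) => v) ∘ σ) (t v)) := by
  refine ⟨fun w => primeUnit p (𝔽.k w) ^ (j ^ 2), primeUnit p (𝔽.k v),
    fun j' e' => pilotRegion p 𝔽 e' (primeUnit p (𝔽.k (e' (Fin.last j'))) ^ (j' ^ 2)), ?_, ?_, ?_⟩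
  · simp only [Units.val_pow_eq_pow_val, coe_primeUnit, norm_pow]
  · rw [coe_primeUnit]
    exact norm_prime_lt_one p (𝔽.k v)
  · intro σ
    exact Subset.rfl

/-- The pre-hull reading at `v⃗` and all five hull-level readings of XXVI fail together under XXVI's hypothesis
(which implies this file's: the discrepancy is nonnegative up to the tame term — here simply assumed alongside).
[folklore] -/
theorem all_readings_fail {j : ℕ} (hj : 1 ≤ j) (e : Fin (j + 1) → placesOver F p)
    (t : ∀ v : placesOver F p, (𝔽.k v)ˣ) (B : (realPrimePacket p 𝔽).Region)
    (hB : ∀ σ : Equiv.Perm (Fin (j + 1)), B j (e ∘ σ) ⊆ pilotRegion p 𝔽 (e ∘ σ) (t (e (σ (Fin.last j)))))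
    (hB1 : pilotRegion p 𝔽 e (t (e (Fin.last j))) ⊆ B j e)
    (Istar : Finset (Fin (j + 1))) (htame : ∀ i, i ∉ Istar → absRamificationIdx p (𝔽.k (e i)) ≤ p - 2)
    (i₀ : Fin (j + 1)) (hmax : ∀ i, ‖(t (e i) : 𝔽.k (e i))‖ ≤ ‖(t (e i₀) : 𝔽.k (e i₀))‖)
    (q : (𝔽.k (e (Fin.last j)))ˣ)
    (hlt : Real.log ‖(t (e i₀) : 𝔽.k (e i₀))‖ < Real.log ‖(q : 𝔽.k (e (Fin.last j)))‖)
    (hdeep : Real.log ‖(t (e i₀) : 𝔽.k (e i₀))‖ + (dSum p (fun i => 𝔽.k (e i)) + 1) * Real.log p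
        + ∑ i ∈ Istar, (3 + Real.log (absRamificationIdx p (𝔽.k (e i)))) <
      Real.log ‖(q : 𝔽.k (e (Fin.last j)))‖) :
    ¬ SingleImageReading p 𝔽 e q B ∧ ¬ VolumeReading p 𝔽 e q B ∧ ¬ SubsetReading p 𝔽 e q B ∧
      ¬ MemReading p 𝔽 e q B ∧ ¬ IsoReading p 𝔽 e q B ∧ ¬ IsoVolReading p 𝔽 e q B :=
  ⟨not_singleImageReading p 𝔽 e t B hB i₀ hmax q hlt,
    readings_fail_of_deep hj e t B hB hB1 Istar htame i₀ hmax q hdeep⟩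

end Summit.ABC.IUTFork.PacketReal

end
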